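import Mathlib
import HarnessLib
import Summits.ValiantsHypothesis.ValiantsHypothesis.Theorems.MonotoneRestorationOrbitRestorationQPSeparableEngine
import Summits.ValiantsHypothesis.ValiantsHypothesis.Theorems.MonotoneRestorationOrbitRestorationQPStableLocalPolyFactors

/-!
# Super-atoms: polynomials in the row-placement power sums of a column core are narrow (treewidth `≤ c + 1`)

Route MonotoneRestoration, crux `OrbitRestorationQP` (stmt-ValiantsHypothesis-18293), SPAN-currency lane of the open
sub-rung A_∞ (`stub_sigmaPiSigmaValue`), `ΠΣ` part; repair-census item "SEPARABLE ENGINE" of `BLOCK-LANE-g7g5.md` (R3,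
the sign-twisted support blocks), second half.  Helper (`--supports`), def-free.

For a placed column core `ψ : Fin c → [n]`, the ROW ATOMS of row `a` are `x_{a, ψ b}` (`b < c`) and the row sum
`R_a`, indexed by `κ = Fin c ⊕ Unit`; the SUPER-ATOMS are the polarized power sums over the rows,
`S_γ(ψ) = Σ_a Π_{k ∈ κ} (atom_k(a))^{γ k}` (`γ : κ → ℕ`) — exactly the generators of the multisymmetric polynomials
(`MultisymmetricPowerSums.mem_adjoin_powerSums_of_rowSymmetric`) evaluated at the row atoms.  A polynomial in the
super-atoms placed at `ψ` is `aeval (S_•(ψ)) Q`, `Q ∈ MvPolynomial (κ → ℕ) ℂ`.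

* `prod_superAtoms_eq_sum_placements` — a word of super-atoms is an all-ROW-placements sum of a monomial in the
  ordinary local atoms of the core `Fin K × Fin c` (`K` = length of the word);
* **`sum_placements_aeval_superAtoms_mem_narrowSpan`** — `Σ_ψ aeval (S_•(ψ)) Q ∈ span_ℂ {hom_{F,n} : tw F ≤ c + 1}`
  (the separable engine `CorePatterns.sum_placements_aeval_mem_narrowSpan_col`);
* `aeval_superAtoms_comp`, `sum_injective_aeval_superAtoms_mem_narrowSpan` — merging the core along a surjection and
  the INJECTIVE-placement version (generic inclusion–exclusion `CorePatterns.sum_injective_mem_of_merge`);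
* `rename_rowCol_aeval_superAtoms` — a row/column renaming `(σ, τ)` moves the placement to `τ ∘ ψ` (super-atom
  polynomials are ROW-INVARIANT);
* **`prod_mem_narrowSpan_of_stable_superAtomFactors`** — an exactly permuted finite family of injectively placed
  super-atom polynomials (cores `c_i + 1 ≤ w`) has its product in `span_ℂ {hom_{F,n} : tw F ≤ w}` (Newton over the
  orbit, `NarrowSpanNewton.prod_mem_narrowSpan_of_psum_mem`).

Why (lane note): the column-label groupings `G_T` of the sign-twisted blocks are row-(anti)symmetric; `G_T²` and
`G_T · G_{T'}` are row-invariant polynomials in the row atoms of the columns `T ∪ T'`, hence (multisymmetric first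
fundamental theorem) super-atom polynomials — this file is their engine.  No registered stub is closed; the crux and
VP ≠ VNP are not moved. [folklore; cite: DwivediPagoSeppelt2026, §8; Weyl1939, Chap. II §3]
-/

noncomputable section

-- `Summit.ValiantsHypothesis.ValiantsHypothesis.…` is the tree's single-conjunct layout (Sub = Summit).
set_option linter.dupNamespace false

namespace Summit.ValiantsHypothesis.ValiantsHypothesis.Theorems

namespace SuperAtoms

open MvPolynomial Finset Equiv
open Literature.Computability.AlgebraicComplexity (homPoly)
open Literature.Combinatorics.SimpleGraph (treewidth)

/-! ### Words of super-atoms are row-placement sums of monomials in the local atoms -/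

/-- **A word of super-atoms is an all-row-placements sum of a monomial in the local atoms** of the core
`Fin K × Fin c`. [folklore] -/
theorem prod_superAtoms_eq_sum_placements (n c K : ℕ) (w : Fin K → (Fin c ⊕ Unit) → ℕ) (ψ : Fin c → Fin n) :
    (∏ i : Fin K, ∑ a : Fin n, ∏ k : Fin c ⊕ Unit,
      (Sum.elim (fun b : Fin c => (X (a, ψ b) : MvPolynomial (Fin n × Fin n) ℂ))
        (fun _ : Unit => ∑ j : Fin n, (X (a, j) : MvPolynomial (Fin n × Fin n) ℂ)) k) ^ w i k) =
    ∑ φ : Fin K → Fin n,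
      aeval (Sum.elim (fun ab : Fin K × Fin c => (X (φ ab.1, ψ ab.2) : MvPolynomial (Fin n × Fin n) ℂ))
          (Sum.elim (fun a : Fin K => ∑ j : Fin n, (X (φ a, j) : MvPolynomial (Fin n × Fin n) ℂ))
            (fun b : Fin c => ∑ j : Fin n, (X (j, ψ b) : MvPolynomial (Fin n × Fin n) ℂ))))
        (∏ i : Fin K, (∏ b : Fin c, (X (Sum.inl (i, b)) : MvPolynomial ((Fin K × Fin c) ⊕ (Fin K ⊕ Fin c)) ℂ) ^
            w i (Sum.inl b)) * (X (Sum.inr (Sum.inl i))) ^ w i (Sum.inr ())) := by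
  rw [Finset.prod_univ_sum]
  simp only [Fintype.piFinset_univ]
  refine Finset.sum_congr rfl fun φ _ => ?_
  simp only [map_prod, map_mul, map_pow, aeval_X, Sum.elim_inl, Sum.elim_inr, Fintype.prod_sum_type,
    Finset.univ_unique, Finset.prod_singleton, PUnit.default_eq_unit]

/-! ### The super-atom engine -/

/-- **Polynomials in the super-atoms are narrow, treewidth `≤ c + 1`.**  For every `Q ∈ MvPolynomial ((Fin c ⊕ Unit) → ℕ) ℂ`,
`Σ_{ψ : Fin c → [n]} aeval (S_•(ψ)) Q ∈ span_ℂ {hom_{F,n} : tw F ≤ c + 1}`. [folklore; cite: DwivediPagoSeppelt2026, §8] -/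
theorem sum_placements_aeval_superAtoms_mem_narrowSpan (n c : ℕ) (Q : MvPolynomial ((Fin c ⊕ Unit) → ℕ) ℂ) :
    (∑ ψ : Fin c → Fin n,
      aeval (fun γ : (Fin c ⊕ Unit) → ℕ => ∑ a : Fin n, ∏ k : Fin c ⊕ Unit,
        (Sum.elim (fun b : Fin c => (X (a, ψ b) : MvPolynomial (Fin n × Fin n) ℂ))
          (fun _ : Unit => ∑ j : Fin n, (X (a, j) : MvPolynomial (Fin n × Fin n) ℂ)) k) ^ γ k) Q) ∈
    Submodule.span ℂ {p : MvPolynomial (Fin n × Fin n) ℂ |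
        ∃ (a b : ℕ) (E : Multiset (Fin a × Fin b)),
          treewidth (SimpleGraph.fromRel fun u v : Fin a ⊕ Fin b =>
            ∃ e ∈ E, u = Sum.inl e.1 ∧ v = Sum.inr e.2) ≤ c + 1 ∧ p = homPoly E n ℂ} := by
  classical
  have hQ : ∀ ψ : Fin c → Fin n,
      aeval (fun γ : (Fin c ⊕ Unit) → ℕ => ∑ a : Fin n, ∏ k : Fin c ⊕ Unit,
        (Sum.elim (fun b : Fin c => (X (a, ψ b) : MvPolynomial (Fin n × Fin n) ℂ))
          (fun _ : Unit => ∑ j : Fin n, (X (a, j) : MvPolynomial (Fin n × Fin n) ℂ)) k) ^ γ k) Q =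
      ∑ s ∈ Q.support, C (coeff s Q) *
        s.prod (fun γ k => (∑ a : Fin n, ∏ k : Fin c ⊕ Unit,
          (Sum.elim (fun b : Fin c => (X (a, ψ b) : MvPolynomial (Fin n × Fin n) ℂ))
            (fun _ : Unit => ∑ j : Fin n, (X (a, j) : MvPolynomial (Fin n × Fin n) ℂ)) k) ^ γ k) ^ k) := by
    intro ψ
    conv_lhs => rw [Q.as_sum]
    rw [map_sum]
    refine Finset.sum_congr rfl fun s _ => ?_
    rw [aeval_monomial, algebraMap_eq]
  simp_rw [hQ]
  rw [Finset.sum_comm]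
  refine Submodule.sum_mem _ fun s _ => ?_
  obtain ⟨K, w, hw⟩ := CorePatterns.exists_word_of_finsupp s
  simp_rw [hw (MvPolynomial (Fin n × Fin n) ℂ), prod_superAtoms_eq_sum_placements, ← Finset.mul_sum]
  rw [← MvPolynomial.smul_eq_C_mul, Finset.sum_comm]
  exact Submodule.smul_mem _ _ (CorePatterns.sum_placements_aeval_mem_narrowSpan_col n K c _)

/-! ### Merging the core and injective placements -/

/-- **Placing along `g ∘ π` = placing the exponent-merged polynomial along `g`.** [folklore] -/
theorem aeval_superAtoms_comp (n c c' : ℕ) (Q : MvPolynomial ((Fin c ⊕ Unit) → ℕ) ℂ) (π : Fin c → Fin c')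
    (g : Fin c' → Fin n) :
    aeval (fun γ : (Fin c ⊕ Unit) → ℕ => ∑ a : Fin n, ∏ k : Fin c ⊕ Unit,
        (Sum.elim (fun b : Fin c => (X (a, (g ∘ π) b) : MvPolynomial (Fin n × Fin n) ℂ))
          (fun _ : Unit => ∑ j : Fin n, (X (a, j) : MvPolynomial (Fin n × Fin n) ℂ)) k) ^ γ k) Q =
    aeval (fun γ' : (Fin c' ⊕ Unit) → ℕ => ∑ a : Fin n, ∏ k : Fin c' ⊕ Unit,
        (Sum.elim (fun b : Fin c' => (X (a, g b) : MvPolynomial (Fin n × Fin n) ℂ))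
          (fun _ : Unit => ∑ j : Fin n, (X (a, j) : MvPolynomial (Fin n × Fin n) ℂ)) k) ^ γ' k)
      (rename (fun γ : (Fin c ⊕ Unit) → ℕ => fun k' : Fin c' ⊕ Unit =>
        Sum.elim (fun b' : Fin c' => ∑ b ∈ (univ : Finset (Fin c)).filter (fun b => π b = b'), γ (Sum.inl b))
          (fun u : Unit => γ (Sum.inr u)) k') Q) := by
  classical
  rw [aeval_rename]
  congr 1
  refine MvPolynomial.algHom_ext fun γ => ?_
  rw [aeval_X, aeval_X, Function.comp_apply]
  refine Finset.sum_congr rfl fun a _ => ?_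
  simp only [Fintype.prod_sum_type, Finset.univ_unique, Finset.prod_singleton, PUnit.default_eq_unit,
    Sum.elim_inl, Sum.elim_inr, Function.comp_apply]
  congr 1
  rw [← Finset.prod_fiberwise_of_maps_to (s := (univ : Finset (Fin c))) (t := (univ : Finset (Fin c')))
    (g := π) (fun b _ => Finset.mem_univ _)]
  refine Finset.prod_congr rfl fun b' _ => ?_
  rw [← Finset.prod_pow_eq_pow_sum]
  refine Finset.prod_congr rfl fun b hb => ?_
  rw [(Finset.mem_filter.1 hb).2]

/-- **INJ for super-atom polynomials**: the sum over INJECTIVE column placements of a polynomial in the super-atoms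
lies in `span_ℂ {hom_{F,n} : tw F ≤ c + 1}`. [folklore; cite: DwivediPagoSeppelt2026, §8] -/
theorem sum_injective_aeval_superAtoms_mem_narrowSpan (n c : ℕ) (Q : MvPolynomial ((Fin c ⊕ Unit) → ℕ) ℂ) :
    (∑ ψ ∈ (univ : Finset (Fin c → Fin n)).filter (fun ψ => Function.Injective ψ),
      aeval (fun γ : (Fin c ⊕ Unit) → ℕ => ∑ a : Fin n, ∏ k : Fin c ⊕ Unit,
        (Sum.elim (fun b : Fin c => (X (a, ψ b) : MvPolynomial (Fin n × Fin n) ℂ))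
          (fun _ : Unit => ∑ j : Fin n, (X (a, j) : MvPolynomial (Fin n × Fin n) ℂ)) k) ^ γ k) Q) ∈
    Submodule.span ℂ {p : MvPolynomial (Fin n × Fin n) ℂ |
        ∃ (a b : ℕ) (E : Multiset (Fin a × Fin b)),
          treewidth (SimpleGraph.fromRel fun u v : Fin a ⊕ Fin b =>
            ∃ e ∈ E, u = Sum.inl e.1 ∧ v = Sum.inr e.2) ≤ c + 1 ∧ p = homPoly E n ℂ} := by
  classical
  refine CorePatterns.sum_injective_mem_of_merge _ c n _ fun c' π hπ => ?_
  have hc'le : c' ≤ c := by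
    have := Fintype.card_le_of_surjective π hπ
    simpa using this
  simp_rw [aeval_superAtoms_comp n c c' Q π]
  refine (Submodule.span_mono ?_) (sum_placements_aeval_superAtoms_mem_narrowSpan n c' _)
  rintro p ⟨a, b, E, hE, rfl⟩
  exact ⟨a, b, E, hE.trans (by omega), rfl⟩

/-! ### Equivariance -/

/-- **A row/column renaming `(σ, τ)` moves the placement of a super-atom polynomial to `τ ∘ ψ`** (the row
renaming is absorbed by the row sum: super-atom polynomials are row-invariant). [folklore] -/
theorem rename_rowCol_aeval_superAtoms (n c : ℕ) (Q : MvPolynomial ((Fin c ⊕ Unit) → ℕ) ℂ) (ψ : Fin c → Fin n)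
    (σ τ : Perm (Fin n)) :
    rename (fun P : Fin n × Fin n => (σ P.1, τ P.2))
      (aeval (fun γ : (Fin c ⊕ Unit) → ℕ => ∑ a : Fin n, ∏ k : Fin c ⊕ Unit,
        (Sum.elim (fun b : Fin c => (X (a, ψ b) : MvPolynomial (Fin n × Fin n) ℂ))
          (fun _ : Unit => ∑ j : Fin n, (X (a, j) : MvPolynomial (Fin n × Fin n) ℂ)) k) ^ γ k) Q) =
    aeval (fun γ : (Fin c ⊕ Unit) → ℕ => ∑ a : Fin n, ∏ k : Fin c ⊕ Unit,
        (Sum.elim (fun b : Fin c => (X (a, (⇑τ ∘ ψ) b) : MvPolynomial (Fin n × Fin n) ℂ))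
          (fun _ : Unit => ∑ j : Fin n, (X (a, j) : MvPolynomial (Fin n × Fin n) ℂ)) k) ^ γ k) Q := by
  rw [← AlgHom.comp_apply, comp_aeval]
  congr 1
  refine MvPolynomial.algHom_ext fun γ => ?_
  rw [aeval_X, aeval_X]
  simp only [Function.comp_apply, map_sum, map_mul, map_prod, map_pow, Fintype.prod_sum_type, Finset.univ_unique,
    Finset.prod_singleton, Sum.elim_inl, Sum.elim_inr, rename_X]
  symm
  rw [← Equiv.sum_comp σ]
  refine Finset.sum_congr rfl fun a _ => ?_
  rw [Equiv.sum_comp τ (fun j => (X (σ a, j) : MvPolynomial (Fin n × Fin n) ℂ))]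

/-! ### Exactly permuted families of super-atom polynomials -/

/-- **Exactly permuted families of injectively placed super-atom polynomials have narrow products.**  If every
`Lf i` is a polynomial in the super-atoms of a column core `Fin c` (`c + 1 ≤ w`) placed injectively, and every
row/column renaming permutes the family exactly, then `Π_i Lf_i ∈ span_ℂ {hom_{F,n} : tw F ≤ w}`.
[folklore; cite: DwivediPagoSeppelt2026, §8] -/
theorem prod_mem_narrowSpan_of_stable_superAtomFactors (n w : ℕ) {ι : Type} [Fintype ι]
    (Lf : ι → MvPolynomial (Fin n × Fin n) ℂ)
    (hstab : ∀ σ τ : Perm (Fin n), ∃ κ : Perm ι, ∀ i,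
      rename (fun P : Fin n × Fin n => (σ P.1, τ P.2)) (Lf i) = Lf (κ i))
    (hloc : ∀ i, ∃ (c : ℕ) (eC : Fin c → Fin n) (Q : MvPolynomial ((Fin c ⊕ Unit) → ℕ) ℂ),
      c + 1 ≤ w ∧ Function.Injective eC ∧
      Lf i = aeval (fun γ : (Fin c ⊕ Unit) → ℕ => ∑ a : Fin n, ∏ k : Fin c ⊕ Unit,
        (Sum.elim (fun b : Fin c => (X (a, eC b) : MvPolynomial (Fin n × Fin n) ℂ))
          (fun _ : Unit => ∑ j : Fin n, (X (a, j) : MvPolynomial (Fin n × Fin n) ℂ)) k) ^ γ k) Q) :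
    (∏ i, Lf i) ∈ Submodule.span ℂ {p : MvPolynomial (Fin n × Fin n) ℂ |
        ∃ (a b : ℕ) (E : Multiset (Fin a × Fin b)),
          treewidth (SimpleGraph.fromRel fun u v : Fin a ⊕ Fin b =>
            ∃ e ∈ E, u = Sum.inl e.1 ∧ v = Sum.inr e.2) ≤ w ∧ p = homPoly E n ℂ} := by
  classical
  refine NarrowSpanNewton.prod_mem_narrowSpan_of_psum_mem n w Lf fun m => ?_
  -- |G| • P_m = Σ_i Σ_{σ,τ} ((σ,τ)·Lf_i)^m
  have hG : ∀ σ τ : Perm (Fin n), (∑ i, (rename (fun P : Fin n × Fin n => (σ P.1, τ P.2)) (Lf i)) ^ m) =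
      ∑ i, Lf i ^ m := by
    intro σ τ
    obtain ⟨κ, hκ⟩ := hstab σ τ
    simp_rw [hκ]
    exact Equiv.sum_comp κ (fun i => Lf i ^ m)
  have hsum : (∑ i, ∑ σ : Perm (Fin n), ∑ τ : Perm (Fin n),
        (rename (fun P : Fin n × Fin n => (σ P.1, τ P.2)) (Lf i)) ^ m) =
      (Fintype.card (Perm (Fin n)) * Fintype.card (Perm (Fin n))) • ∑ i, Lf i ^ m := by
    rw [Finset.sum_comm]
    have h2 : ∀ σ : Perm (Fin n), (∑ i, ∑ τ : Perm (Fin n),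
        (rename (fun P : Fin n × Fin n => (σ P.1, τ P.2)) (Lf i)) ^ m) =
        Fintype.card (Perm (Fin n)) • ∑ i, Lf i ^ m := by
      intro σ
      rw [Finset.sum_comm]
      simp_rw [hG]
      rw [Finset.sum_const, Finset.card_univ]
    simp_rw [h2]
    rw [Finset.sum_const, Finset.card_univ, smul_smul]
  -- each inner double sum is a multiple of an injective-placement sum of `Q ^ m`
  have hmem : (∑ i, ∑ σ : Perm (Fin n), ∑ τ : Perm (Fin n),
        (rename (fun P : Fin n × Fin n => (σ P.1, τ P.2)) (Lf i)) ^ m) ∈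
      Submodule.span ℂ {p : MvPolynomial (Fin n × Fin n) ℂ |
        ∃ (a b : ℕ) (E : Multiset (Fin a × Fin b)),
          treewidth (SimpleGraph.fromRel fun u v : Fin a ⊕ Fin b =>
            ∃ e ∈ E, u = Sum.inl e.1 ∧ v = Sum.inr e.2) ≤ w ∧ p = homPoly E n ℂ} := by
    refine Submodule.sum_mem _ fun i _ => ?_
    obtain ⟨c, eC, Q, hw, heC, hLi⟩ := hloc i
    obtain ⟨N₂, -, hN₂⟩ := CorePatterns.exists_sum_perm_comp_eq eC heC
    rw [hLi]
    simp only [rename_rowCol_aeval_superAtoms, ← map_pow]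
    have h2 : (∑ τ : Perm (Fin n),
        aeval (fun γ : (Fin c ⊕ Unit) → ℕ => ∑ a : Fin n, ∏ k : Fin c ⊕ Unit,
          (Sum.elim (fun b : Fin c => (X (a, (⇑τ ∘ eC) b) : MvPolynomial (Fin n × Fin n) ℂ))
            (fun _ : Unit => ∑ j : Fin n, (X (a, j) : MvPolynomial (Fin n × Fin n) ℂ)) k) ^ γ k) (Q ^ m)) =
        N₂ • ∑ ψ ∈ (univ : Finset (Fin c → Fin n)).filter (fun ψ => Function.Injective ψ),
          aeval (fun γ : (Fin c ⊕ Unit) → ℕ => ∑ a : Fin n, ∏ k : Fin c ⊕ Unit,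
            (Sum.elim (fun b : Fin c => (X (a, ψ b) : MvPolynomial (Fin n × Fin n) ℂ))
              (fun _ : Unit => ∑ j : Fin n, (X (a, j) : MvPolynomial (Fin n × Fin n) ℂ)) k) ^ γ k) (Q ^ m) :=
      hN₂ (fun ψ => aeval (fun γ : (Fin c ⊕ Unit) → ℕ => ∑ a : Fin n, ∏ k : Fin c ⊕ Unit,
        (Sum.elim (fun b : Fin c => (X (a, ψ b) : MvPolynomial (Fin n × Fin n) ℂ))
          (fun _ : Unit => ∑ j : Fin n, (X (a, j) : MvPolynomial (Fin n × Fin n) ℂ)) k) ^ γ k) (Q ^ m))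
    rw [h2, Finset.sum_const, Finset.card_univ]
    refine nsmul_mem (nsmul_mem ?_ _) _
    refine (Submodule.span_mono ?_) (sum_injective_aeval_superAtoms_mem_narrowSpan n c (Q ^ m))
    rintro p ⟨a, b, E, hE, rfl⟩
    exact ⟨a, b, E, hE.trans hw, rfl⟩
  -- divide by |G|
  have hcard : ((Fintype.card (Perm (Fin n)) * Fintype.card (Perm (Fin n)) : ℕ) : ℂ) ≠ 0 := by
    have : 0 < Fintype.card (Perm (Fin n)) := Fintype.card_pos
    exact_mod_cast (Nat.mul_pos this this).ne'
  have : (∑ i, Lf i ^ m) = ((Fintype.card (Perm (Fin n)) * Fintype.card (Perm (Fin n)) : ℕ) : ℂ)⁻¹ •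
      ((Fintype.card (Perm (Fin n)) * Fintype.card (Perm (Fin n))) • ∑ i, Lf i ^ m) := by
    rw [← Nat.cast_smul_eq_nsmul ℂ, inv_smul_smul₀ hcard]
  rw [this, ← hsum]
  exact Submodule.smul_mem _ _ hmem

end SuperAtoms

end Summit.ValiantsHypothesis.ValiantsHypothesis.Theorems

end
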